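import Literature.Analysis.Complex.LogDerivZeros
import Mathlib.Analysis.Calculus.LogDeriv
import Mathlib.Analysis.SpecialFunctions.Log.Basic
import HarnessLib

/-!
# Stub `stub_localGHL` of the crux skeleton `DefiniteXi.PeterssonLowerBound` (stmt-ABC-10870), line Sketch: the disc-local Goldfeld–Hoffstein–Lieman repulsion lemma (Titchmarsh Lemma α).

The abstract complex-analysis engine of the Goldfeld–Hoffstein–Lieman argument: if `G` is
holomorphic on `|s - 1| < ρ` with `|(s-β)^{m+1} G(s)| ≤ e^B`, all its zeros in `Re s ≤ 1`, and
`(s-β)^{m+1} G = (s-1)^m Z` where `Z` has `|Z| ≥ 1`, `Re Z'/Z ≤ 0` on the real axis right of `1`,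
then `β ≤ 1 - c(m, ρ)/B`. Proof: Titchmarsh's Lemma α
(`Literature.Analysis.Complex.titchmarsh_logDeriv_sub_sum_of_differentiableOn`) for `G` at
`σ₀ = 1 + (2m+1)(1-β)` with radius `ρ/8`, dropping the non-negative zero sum, against the
logarithmic differentiation of the identity at `σ₀`.
-/

noncomputable section

open scoped Real Topology
open Set Filter Metric Complex

-- the summit-side namespace `Summit.ABC.ABC.Theorems` (summit = problem = `ABC`) is fixed by the tree layout
set_option linter.dupNamespace false

namespace Summit.ABC.ABC.Theorems

/-- Logarithmic differentiation of the identity `(s-b)^{m+1} G(s) = (s-1)^m Z(s)` (valid near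
`s₀`) at a point `s₀ ∉ {1, b}` with `G(s₀) Z(s₀) ≠ 0`:
`G'/G(s₀) = m/(s₀-1) + Z'/Z(s₀) - (m+1)/(s₀-b)`; differentiability of `Z` at `s₀` follows from
that of `G`. [folklore] -/
theorem localGHL_logDeriv_identity {G Z : ℂ → ℂ} {m : ℕ} {b s₀ : ℂ}
    (hG : DifferentiableAt ℂ G s₀)
    (heq : ∀ᶠ s in 𝓝 s₀, (s - b) ^ (m + 1) * G s = (s - 1) ^ m * Z s)
    (h1 : s₀ ≠ 1) (hb : s₀ ≠ b) (hG0 : G s₀ ≠ 0) (hZ0 : Z s₀ ≠ 0) :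
    deriv G s₀ / G s₀ = m / (s₀ - 1) + deriv Z s₀ / Z s₀ - (m + 1) / (s₀ - b) := by
  have hp : s₀ - b ≠ 0 := sub_ne_zero.2 hb
  have hq : s₀ - 1 ≠ 0 := sub_ne_zero.2 h1
  have hP : HasDerivAt (fun s : ℂ ↦ (s - b) ^ (m + 1))
      (((m + 1 : ℕ) : ℂ) * (s₀ - b) ^ (m + 1 - 1) * 1) s₀ :=
    ((hasDerivAt_id' s₀).sub_const b).fun_pow (m + 1)
  have hQ : HasDerivAt (fun s : ℂ ↦ (s - 1) ^ m) ((m : ℂ) * (s₀ - 1) ^ (m - 1) * 1) s₀ :=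
    ((hasDerivAt_id' s₀).sub_const 1).fun_pow m
  have hPd : DifferentiableAt ℂ (fun s : ℂ ↦ (s - b) ^ (m + 1)) s₀ := hP.differentiableAt
  have hQd : DifferentiableAt ℂ (fun s : ℂ ↦ (s - 1) ^ m) s₀ := hQ.differentiableAt
  -- `Z` is differentiable at `s₀`
  have hZeq : Z =ᶠ[𝓝 s₀] fun s ↦ (s - b) ^ (m + 1) * G s / (s - 1) ^ m := by
    filter_upwards [heq, eventually_ne_nhds h1] with s hs hs1
    rw [hs, mul_div_cancel_left₀ _ (pow_ne_zero _ (sub_ne_zero.2 hs1))]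
  have hZd : DifferentiableAt ℂ Z s₀ :=
    ((hPd.mul hG).div hQd (pow_ne_zero _ hq)).congr_of_eventuallyEq hZeq
  -- the two sides have the same logarithmic derivative at `s₀`
  have hev : (fun s ↦ (s - b) ^ (m + 1) * G s) =ᶠ[𝓝 s₀] (fun s ↦ (s - 1) ^ m * Z s) := heq
  have h0 : (s₀ - b) ^ (m + 1) * G s₀ = (s₀ - 1) ^ m * Z s₀ := heq.self_of_nhds
  have hlog : logDeriv (fun s ↦ (s - b) ^ (m + 1) * G s) s₀ =
      logDeriv (fun s ↦ (s - 1) ^ m * Z s) s₀ := by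
    rw [logDeriv_apply, logDeriv_apply, hev.deriv_eq, h0]
  have hL : logDeriv (fun s ↦ (s - b) ^ (m + 1) * G s) s₀ =
      logDeriv (fun s : ℂ ↦ (s - b) ^ (m + 1)) s₀ + logDeriv G s₀ :=
    logDeriv_mul (f := fun s : ℂ ↦ (s - b) ^ (m + 1)) (g := G) s₀ (pow_ne_zero _ hp) hG0 hPd hG
  have hR : logDeriv (fun s ↦ (s - 1) ^ m * Z s) s₀ =
      logDeriv (fun s : ℂ ↦ (s - 1) ^ m) s₀ + logDeriv Z s₀ :=
    logDeriv_mul (f := fun s : ℂ ↦ (s - 1) ^ m) (g := Z) s₀ (pow_ne_zero _ hq) hZ0 hQd hZd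
  rw [hL, hR] at hlog
  have hP' : logDeriv (fun s : ℂ ↦ (s - b) ^ (m + 1)) s₀ = (m + 1) / (s₀ - b) := by
    rw [logDeriv_apply, hP.deriv, Nat.add_sub_cancel, mul_one, Nat.cast_succ,
      div_eq_div_iff (pow_ne_zero _ hp) hp]
    ring
  have hQ' : logDeriv (fun s : ℂ ↦ (s - 1) ^ m) s₀ = m / (s₀ - 1) := by
    rw [logDeriv_apply, hQ.deriv, mul_one, div_eq_div_iff (pow_ne_zero _ hq) hq]
    cases m with
    | zero => simp
    | succ k => rw [Nat.add_sub_cancel]; ring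
  rw [hP', hQ', logDeriv_apply, logDeriv_apply] at hlog
  linear_combination hlog

/-- The zero sum of Titchmarsh's Lemma α has non-negative real part to the right of the zeros:
if `Re a ≤ Re s₀` for all `a ∈ S` then `Re ∑_{a ∈ S} m(a)/(s₀ - a) ≥ 0`. [folklore] -/
theorem localGHL_re_sum_nonneg {S : Finset ℂ} {mult : ℂ → ℕ} {s₀ : ℂ}
    (h : ∀ a ∈ S, a.re ≤ s₀.re) : 0 ≤ (∑ a ∈ S, (mult a : ℂ) / (s₀ - a)).re := by
  rw [Complex.re_sum]
  refine Finset.sum_nonneg fun a ha ↦ ?_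
  rw [Complex.div_re, Complex.natCast_re, Complex.natCast_im, zero_mul, zero_div, add_zero]
  refine div_nonneg (mul_nonneg (Nat.cast_nonneg _) ?_) (Complex.normSq_nonneg _)
  rw [Complex.sub_re]
  linarith [h a ha]

/-- **Local GHL lemma.** Let `G` be holomorphic on the ball `|s - 1| < ρ`, with
`|(s-β)^{m+1} G(s)| ≤ e^B` there, all zeros of `G` in the ball in `Re s ≤ 1`, and
`(s-β)^{m+1} G(s) = (s-1)^m Z(s)` for `s ≠ 1`, where on the real interval `(1, 1+ρ)` one has
`|Z| ≥ 1` and `Re Z'/Z ≤ 0` (the shape of a Dirichlet series with non-negative coefficients,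
`a(1) = 1`, a pole of order `m` at `1` and a zero of order `≥ m+1` at the real point `β < 1`). Then
`β ≤ 1 - c/B` with `c = c(m, ρ) > 0`. (Titchmarsh Lemma α at `σ₀ = 1 + (2m+1)(1-β)` applied to `G`,
dropping the non-negative zero sum.) [cite: HoffsteinLockhart1994, Appendix (Goldfeld–Hoffstein–Lieman), Lemma] -/
theorem stub_localGHL (m : ℕ) {ρ : ℝ} (hρ : 0 < ρ) : ∃ c : ℝ, 0 < c ∧
    ∀ (G Z : ℂ → ℂ) (B β : ℝ), 1 ≤ B → β < 1 →
      DifferentiableOn ℂ G (ball (1 : ℂ) ρ) →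
      (∀ s ∈ ball (1 : ℂ) ρ, ‖(s - β) ^ (m + 1) * G s‖ ≤ Real.exp B) →
      (∀ s ∈ ball (1 : ℂ) ρ, G s = 0 → s.re ≤ 1) →
      (∀ s ∈ ball (1 : ℂ) ρ, s ≠ 1 → (s - β) ^ (m + 1) * G s = (s - 1) ^ m * Z s) →
      (∀ σ : ℝ, 1 < σ → σ < 1 + ρ → 1 ≤ ‖Z σ‖) →
      (∀ σ : ℝ, 1 < σ → σ < 1 + ρ → (deriv Z σ / Z σ).re ≤ 0) →
      β ≤ 1 - c / B := by
  -- the constants (depending on `m` and `ρ` only)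
  have hm0 : (0 : ℝ) < 2 * m + 1 := by positivity
  have hm0' : (2 * (m : ℝ) + 1) ≠ 0 := hm0.ne'
  have hm1 : ((m : ℝ) + 1) ≠ 0 := by positivity
  obtain ⟨η₀, hη₀⟩ : ∃ η₀ : ℝ, η₀ = ρ / (16 * (m + 1)) := ⟨_, rfl⟩
  obtain ⟨Y, hY⟩ : ∃ Y : ℝ, Y = (2 * m + 2) ^ (m + 1) / (2 * m + 1) ^ m := ⟨_, rfl⟩
  obtain ⟨X, hX⟩ : ∃ X : ℝ, X = Y / (ρ / 8) ^ (m + 1) := ⟨_, rfl⟩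
  obtain ⟨K, hK⟩ : ∃ K : ℝ, K = X * η₀ := ⟨_, rfl⟩
  obtain ⟨C₁, hC₁⟩ : ∃ C₁ : ℝ, C₁ = 64 * (1 + K) / ρ := ⟨_, rfl⟩
  have hη₀pos : 0 < η₀ := by rw [hη₀]; positivity
  have hYpos : 0 < Y := by rw [hY]; positivity
  have hXpos : 0 < X := by rw [hX]; positivity
  have hK0 : 0 ≤ K := by rw [hK]; positivity
  have hC₁pos : 0 < C₁ := by rw [hC₁]; positivity
  refine ⟨min η₀ (1 / (2 * (2 * m + 1) * C₁)), lt_min hη₀pos (by positivity), ?_⟩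
  intro G Z B β hB hβ hGd hbd hzero hid hZ1 hZ'
  have hBpos : 0 < B := by linarith
  have hcB : min η₀ (1 / (2 * (2 * m + 1) * C₁)) / B ≤ 1 / (2 * (2 * m + 1) * C₁ * B) :=
    calc min η₀ (1 / (2 * (2 * m + 1) * C₁)) / B ≤ 1 / (2 * (2 * m + 1) * C₁) / B :=
          div_le_div_of_nonneg_right (min_le_right _ _) hBpos.le
      _ = 1 / (2 * (2 * m + 1) * C₁ * B) := by rw [div_div]
  obtain ⟨η, hη⟩ : ∃ η : ℝ, η = 1 - β := ⟨_, rfl⟩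
  have hηpos : 0 < η := by rw [hη]; linarith
  rcases le_or_gt η₀ η with hcase | hcase
  · -- far from `1`: the trivial case
    have h1 : min η₀ (1 / (2 * (2 * m + 1) * C₁)) ≤ η₀ := min_le_left _ _
    have h2 : min η₀ (1 / (2 * (2 * m + 1) * C₁)) / B ≤ min η₀ (1 / (2 * (2 * m + 1) * C₁)) :=
      div_le_self (le_min hη₀pos.le (by positivity)) hB
    linarith
  -- the main case `η < η₀`
  have h2η : (2 * m + 2) * η < ρ / 8 := by
    have : (2 * m + 2) * η < (2 * m + 2) * η₀ := by gcongr
    calc (2 * m + 2) * η < (2 * m + 2) * η₀ := this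
      _ = ρ / 8 := by rw [hη₀]; field_simp; ring
  obtain ⟨σ₀, hσ₀⟩ : ∃ σ₀ : ℝ, σ₀ = 1 + (2 * m + 1) * η := ⟨_, rfl⟩
  have hd : 0 < (2 * m + 1) * η := by positivity
  have ha : 0 < (2 * m + 2) * η := by positivity
  have hda : (2 * m + 1) * η < (2 * m + 2) * η := by nlinarith
  have hσ₀1 : 1 < σ₀ := by rw [hσ₀]; linarith
  have hσ₀ρ : σ₀ < 1 + ρ := by rw [hσ₀]; linarith
  have e1 : (σ₀ : ℂ) - 1 = (((2 * m + 1) * η : ℝ) : ℂ) := by rw [hσ₀]; push_cast; ring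
  have e2 : (σ₀ : ℂ) - (β : ℂ) = (((2 * m + 2) * η : ℝ) : ℂ) := by
    have : β = 1 - η := by linarith
    rw [hσ₀, this]; push_cast; ring
  have hn1 : ‖(σ₀ : ℂ) - 1‖ = (2 * m + 1) * η := by
    rw [e1, Complex.norm_real, Real.norm_of_nonneg hd.le]
  have hn2 : ‖(σ₀ : ℂ) - β‖ = (2 * m + 2) * η := by
    rw [e2, Complex.norm_real, Real.norm_of_nonneg ha.le]
  have hσ₀ne : (σ₀ : ℂ) ≠ 1 := by
    intro h; rw [h, sub_self, norm_zero] at hn1; linarith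
  have hσ₀neβ : (σ₀ : ℂ) ≠ β := by
    intro h; rw [h, sub_self, norm_zero] at hn2; linarith
  have hσ₀ball : (σ₀ : ℂ) ∈ ball (1 : ℂ) ρ := mem_ball_iff_norm.2 (by rw [hn1]; linarith)
  have hsub : ball (σ₀ : ℂ) (ρ / 2) ⊆ ball (1 : ℂ) ρ := by
    intro z hz
    rw [mem_ball_iff_norm] at hz ⊢
    calc ‖z - 1‖ ≤ ‖z - σ₀‖ + ‖(σ₀ : ℂ) - 1‖ := norm_sub_le_norm_sub_add_norm_sub _ _ _
      _ < ρ := by rw [hn1]; linarith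
  have hGd2 : DifferentiableOn ℂ G (ball (σ₀ : ℂ) (ρ / 2)) := hGd.mono hsub
  -- values at `σ₀`
  have hZ1' : 1 ≤ ‖Z σ₀‖ := hZ1 σ₀ hσ₀1 hσ₀ρ
  have hZ0 : Z σ₀ ≠ 0 := norm_pos_iff.1 (by linarith)
  have hE : ((((2 * m + 2) * η : ℝ) : ℂ)) ^ (m + 1) * G σ₀ =
      ((((2 * m + 1) * η : ℝ) : ℂ)) ^ m * Z σ₀ := by
    rw [← e1, ← e2]; exact hid _ hσ₀ball hσ₀ne
  have hG0 : G σ₀ ≠ 0 := by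
    intro h0
    rw [h0, mul_zero] at hE
    exact mul_ne_zero (pow_ne_zero _ (Complex.ofReal_ne_zero.2 hd.ne')) hZ0 hE.symm
  have hGpos : 0 < ‖G σ₀‖ := norm_pos_iff.2 hG0
  have hnormE : ((2 * m + 2) * η) ^ (m + 1) * ‖G σ₀‖ = ((2 * m + 1) * η) ^ m * ‖Z σ₀‖ := by
    have := congrArg (‖·‖) hE
    simpa only [norm_mul, norm_pow, Complex.norm_real, Real.norm_of_nonneg hd.le,
      Real.norm_of_nonneg ha.le] using this
  -- the bound `M` for `G` on `closedBall σ₀ (ρ/4)` (maximum modulus)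
  obtain ⟨M, hM⟩ : ∃ M : ℝ, M = Real.exp B / (ρ / 8) ^ (m + 1) := ⟨_, rfl⟩
  have hMpos : 0 < M := by rw [hM]; positivity
  have hMbd : ∀ z ∈ closedBall (σ₀ : ℂ) (2 * (ρ / 8)), ‖G z‖ ≤ M := by
    intro z hz
    have h4 : (2 * (ρ / 8)) ≠ 0 := by positivity
    have hcl : closedBall (σ₀ : ℂ) (2 * (ρ / 8)) ⊆ ball (σ₀ : ℂ) (ρ / 2) :=
      closedBall_subset_ball (by linarith)
    refine Complex.norm_le_of_forall_mem_frontier_norm_le isBounded_ball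
      (hGd2.diffContOnCl_ball hcl) ?_ ?_
    · rw [frontier_ball _ h4]
      intro w hw
      have hw' : ‖w - σ₀‖ = 2 * (ρ / 8) := mem_sphere_iff_norm.1 hw
      have hw1 : w ∈ ball (1 : ℂ) ρ := mem_ball_iff_norm.2 (by
        calc ‖w - 1‖ ≤ ‖w - σ₀‖ + ‖(σ₀ : ℂ) - 1‖ := norm_sub_le_norm_sub_add_norm_sub _ _ _
          _ < ρ := by rw [hw', hn1]; linarith)
      have hwβ : ρ / 8 ≤ ‖w - β‖ := by
        have h3 : ‖w - σ₀‖ ≤ ‖w - β‖ + ‖(β : ℂ) - σ₀‖ := norm_sub_le_norm_sub_add_norm_sub _ _ _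
        rw [norm_sub_rev (β : ℂ) σ₀, hn2, hw'] at h3
        linarith
      have hb := hbd w hw1
      rw [norm_mul, norm_pow] at hb
      have h5 : (ρ / 8) ^ (m + 1) * ‖G w‖ ≤ Real.exp B :=
        le_trans (mul_le_mul_of_nonneg_right (pow_le_pow_left₀ (by positivity) hwβ _)
          (norm_nonneg _)) hb
      rw [hM, le_div_iff₀ (by positivity), mul_comm]
      exact h5
    · rw [closure_ball _ h4]; exact hz
  -- Titchmarsh's Lemma α for `G` at `σ₀`, radius `ρ/8`
  obtain ⟨S, mult, ψ, hS, -, -, hψeq, hψbd, -⟩ :=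
    Literature.Analysis.Complex.titchmarsh_logDeriv_sub_sum_of_differentiableOn
      (R := ρ / 8) (R₀ := ρ / 2) hGd2 (by linarith) hG0 (by positivity) hMbd
  have hψσ₀ := hψeq (σ₀ : ℂ) (mem_ball_self (by positivity)) hG0
  have hψn := hψbd (σ₀ : ℂ) (mem_closedBall_self (by positivity))
  -- lower bound for `‖G σ₀‖`: `M / ‖G σ₀‖ ≤ e^B · X · η`
  have hratio : M / ‖G σ₀‖ ≤ Real.exp B * (X * η) := by
    rw [div_le_iff₀ hGpos]
    have hdm : (0 : ℝ) < ((2 * m + 1) * η) ^ m := by positivity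
    have hYd : Y * η * ((2 * m + 1) * η) ^ m = ((2 * m + 2) * η) ^ (m + 1) := by
      rw [hY, mul_pow, mul_pow, div_mul_eq_mul_div, div_mul_eq_mul_div,
        div_eq_iff (pow_ne_zero _ hm0')]
      ring
    have h1 : 1 ≤ Y * η * ‖G σ₀‖ := by
      refine le_of_mul_le_mul_right ?_ hdm
      calc 1 * ((2 * m + 1) * η) ^ m = ((2 * m + 1) * η) ^ m := one_mul _
        _ ≤ ((2 * m + 1) * η) ^ m * ‖Z σ₀‖ := le_mul_of_one_le_right hdm.le hZ1'
        _ = ((2 * m + 2) * η) ^ (m + 1) * ‖G σ₀‖ := hnormE.symm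
        _ = Y * η * ‖G σ₀‖ * ((2 * m + 1) * η) ^ m := by rw [← hYd]; ring
    calc M = M * 1 := (mul_one _).symm
      _ ≤ M * (Y * η * ‖G σ₀‖) := mul_le_mul_of_nonneg_left h1 hMpos.le
      _ = Real.exp B * (X * η) * ‖G σ₀‖ := by rw [hM, hX]; ring
  have hlog : Real.log (M / ‖G σ₀‖) + 1 ≤ B + K := by
    have hpos : 0 < M / ‖G σ₀‖ := div_pos hMpos hGpos
    have hXη : 0 < X * η := mul_pos hXpos hηpos
    calc Real.log (M / ‖G σ₀‖) + 1 ≤ Real.log (Real.exp B * (X * η)) + 1 := by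
          gcongr
      _ = B + Real.log (X * η) + 1 := by
          rw [Real.log_mul (Real.exp_pos B).ne' hXη.ne', Real.log_exp]
      _ ≤ B + (X * η - 1) + 1 := by gcongr; exact Real.log_le_sub_one_of_pos hXη
      _ = B + X * η := by ring
      _ ≤ B + X * η₀ := by gcongr
      _ = B + K := by rw [hK]
  have hψC : ‖ψ σ₀‖ ≤ C₁ * B := by
    have hBK : B + K ≤ (1 + K) * B := by nlinarith
    calc ‖ψ σ₀‖ ≤ 8 * (Real.log (M / ‖G σ₀‖) + 1) / (ρ / 8) := hψn
      _ ≤ 8 * (B + K) / (ρ / 8) := by gcongr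
      _ = 64 * (B + K) / ρ := by field_simp; ring
      _ ≤ 64 * ((1 + K) * B) / ρ := by gcongr
      _ = C₁ * B := by rw [hC₁]; ring
  -- real parts: lower bound from Lemma α (the zero sum has non-negative real part)
  have hre_lower : -‖ψ σ₀‖ ≤ (deriv G σ₀ / G σ₀).re := by
    have hsum : 0 ≤ (∑ a ∈ S, (mult a : ℂ) / (σ₀ - a)).re := by
      refine localGHL_re_sum_nonneg fun a haS ↦ ?_
      obtain ⟨hGa, -, haσ⟩ := hS a haS
      have ha1 : a ∈ ball (1 : ℂ) ρ := mem_ball_iff_norm.2 (by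
        calc ‖a - 1‖ ≤ ‖a - σ₀‖ + ‖(σ₀ : ℂ) - 1‖ := norm_sub_le_norm_sub_add_norm_sub _ _ _
          _ < ρ := by rw [hn1]; linarith)
      have := hzero a ha1 hGa
      rw [Complex.ofReal_re]
      linarith
    have hsplit : deriv G σ₀ / G σ₀ = ψ σ₀ + ∑ a ∈ S, (mult a : ℂ) / (σ₀ - a) := by
      rw [hψσ₀]; ring
    rw [hsplit, Complex.add_re]
    have := (abs_le.1 (Complex.abs_re_le_norm (ψ σ₀))).1
    linarith
  -- real parts: upper bound from the logarithmic differentiation of the identity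
  have hev : ∀ᶠ s in 𝓝 (σ₀ : ℂ), (s - β) ^ (m + 1) * G s = (s - 1) ^ m * Z s := by
    filter_upwards [isOpen_ball.mem_nhds hσ₀ball, eventually_ne_nhds hσ₀ne] with s hs hs1
    exact hid s hs hs1
  have hidt := localGHL_logDeriv_identity
    (hGd.differentiableAt (isOpen_ball.mem_nhds hσ₀ball)) hev hσ₀ne hσ₀neβ hG0 hZ0
  have hre_upper : (deriv G σ₀ / G σ₀).re ≤ m / ((2 * m + 1) * η) - (m + 1) / ((2 * m + 2) * η) := by
    rw [hidt, e1, e2]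
    simp only [Complex.sub_re, Complex.add_re, Complex.div_ofReal_re, Complex.natCast_re,
      Complex.one_re]
    linarith [hZ' σ₀ hσ₀1 hσ₀ρ]
  -- combine
  have key : 1 / (2 * (2 * m + 1) * η) ≤ C₁ * B := by
    have : (m : ℝ) / ((2 * m + 1) * η) - (m + 1) / ((2 * m + 2) * η) =
        -(1 / (2 * (2 * m + 1) * η)) := by
      field_simp; ring
    linarith [hre_lower, hre_upper, hψC]
  have hη_lower : 1 / (2 * (2 * m + 1) * C₁ * B) ≤ η := by
    rw [div_le_iff₀ (by positivity)] at key
    rw [div_le_iff₀ (by positivity)]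
    linarith [key]
  linarith [hη_lower, hcB, hη]

end Summit.ABC.ABC.Theorems

end
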